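import Summits.BirchSwinnertonDyer.Rank1Residual.X11b.Three.StepLHalves
import HarnessLib

/-!
# X11b @ `p = 3`, HALVES@3 — the ORIENTATION-REPAIRED H3 atom `Three.IMCDivAt₃B`: the BDP-side
# main-conjecture divisibility at `3 ∥ N` with the Selmer X-slot at the prime OPPOSITE to the frame's
# (routes `ClassRecordThree` ∕ `KolyvaginRoadThree`, items 19494 `IMCDivTwoLociAtThree` ∕ 19506
# `IMCDivTwoLociTamAtThree`; ORIENT-AUDIT-19270 form (a), plan g30 RULINGS 1–2)

Cell `bsd-stepL` (run/shared/lean/pub/bsd-stepL/), seat `bsd-stepL-bdp` (prover g16, 2026-08-27;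
H1@3 owner, fallback hand for the @3 repair per plan g30 RULING 1 (E) ∕ RULING 2 (G4)).
`--supports stmt-BirchSwinnertonDyer-19494 --as helper`. ONE definition with body (`@[conjecture]`,
an OPEN named input stated in the tree's own vocabulary — an obligation node, NOT a vendored fact) and
one bookkeeping theorem; no named fact, no `sorry`.

## Why (verbatim from the cell's audit of record)

ORIENT-AUDIT-19270 (imc-p1 g8, `HOME/audit/ORIENT-AUDIT-19270-imc-p1-g8.md` sha16 b8dcdfb3a75f2807,
referee g38 PASS; print side lit g15 4d9941d6ed538855; origin bsd-eis c3h-MEMO-2 243284d160136e19): the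
tree's `XAc` carries the PRECOMPOSITION `Λ`-action (`XAc.X_smul_apply`), so `X_ac` at the `Λ`-character
`γ ↦ u` controls `Sel(K, E[p^∞] ⊗ ρ⁻¹)`, `ρ(γ) = u`; with the tree's avatar conventions
(`HasInfinityType (n)(−n)`, `IsPAdicAvatarOf`) the Selmer module paired with a BDP frame at `(ι', 𝔭)` is
`X_ac` STRICT AT THE OTHER PRIME `𝔭̄` (family-B layout of Keller–Yin 2024 ∕ CGLS 2022: frame at
`(ι', v)`, `X` strict at `v̄`). The registered H3 atom `Three.IMCDivAt₃` (x11b3 `StepLHalves.lean`) pairs the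
frame at `(ι', 𝔭)` with `XAc … 3 κ 𝔭 ∅ γ` (the SAME prime) and therefore states «the faithful one-sided
divisibility ∧ an unprinted `ι`-invariance». Repair form (a) (Q4, adopted by plan g30 RULING 1): keep
every print-facing binder (datum, frame, `InducesPrime ι' 𝔭`, `IsBDPLFunction ι' 𝔭 …`) VERBATIM and move
ONLY the X-slot to a binder `𝔭bar ∋ 3`, `𝔭bar ≠ 𝔭` — at `p = 3`: «`Three.IMCDivAt₃ᴮ` (`InducesPrime ι' 𝔭 →
IsBDPLFunction ι' 𝔭 … L → ∀ 𝔭bar ∋ 3, 𝔭bar ≠ 𝔭 → Ch(XAc … 3 κ 𝔭bar ∅ γ)·R₀⟦T⟧ ≤ (L)`)». This file types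
exactly that (ASCII name `IMCDivAt₃B`: `ᴮ` is not an identifier character), next to the A-atom, in the
same namespace (`₃`-specialised names live in `…X11b.Three`, OWNERS A6.3 (2)).

* `Three.IMCDivAt₃B W` — H3 at `3 ∥ N`, ORIENTED: over S0's datum, every degree-one `𝔭 ∋ 3`, the
  newform `f`, every `ι'` inducing `𝔭` and every frame `(Ω_K, Ω_p, L)` with Castella's interpolation
  property at `(ι', 𝔭)`, and every prime `𝔭bar ∋ 3` of `K` OTHER than `𝔭`:
  `Ch_Λ(X_ac^∅ at 𝔭bar)·R₀⟦T⟧ ⊆ (L)`.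
* `Three.imcDivAt₃B_of_forall_prime` — bookkeeping: a PRIME-BLIND divisibility (at every `𝔮 ∋ 3`, for
  every frame at `𝔭`) implies the B-atom (and, verbatim, the A-atom): the shape in which a `ι`-invariant
  supplier would serve both orientations. Nothing is asserted.

The T = 0 re-thread (`Three.StepLAt W` from H1 ∧ H2 ∧ H3ᴮ ∧ CTL₀, reading H2 at the CONJUGATE datum so
that no rank input is needed) is the companion `Theorems/ClassRecordThreeStepLOfHalvesB.lean`.

HONEST FRAMING: a definition and an implication; H3 (either orientation) is OPEN at `3 ∥ N` — no printed
BDP-side divisibility at `p = 3` (Wan 2020 ∕ Castella 2018 Thm. 4.4 ∕ Fouquet–Wan 4.41 need `p ≥ 5` or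
are PRE); nothing is discharged, booked or re-labelled (T7); O2 stays OPEN; BSD(E,3) is proved for no class.

References: [Castella2018] §1 (1.b), Thm. 3.3, Thm. 4.4 (arXiv:1704.06608 pp. 3, 9, 11);
[Castella2018Erratum] Thm. 1.1; [KellerYin2024] Def. 3.4.1 ∕ Thm. 3.5.1 (the `(v, v̄)` slotting);
[CastellaGrossiLeeSkinner2022] §2.3 + Lemma 1.1.1; cell audit ORIENT-AUDIT-19270 Q1 ∕ Q4 (a); x11b3
`X11b/Three/StepLHalves.lean` (the A-atom, review checklist R-a…R-m).
-/

noncomputable section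

open scoped Classical

open WeierstrassCurve NumberField IsDedekindDomain Field PowerSeries
  Literature.NumberTheory.EllipticCurves Literature.NumberTheory.EllipticCurves.ModularForms
  Literature.NumberTheory.EllipticCurves.Rank1Residual
  Literature.NumberTheory.GaloisRepresentations
  Summit.BirchSwinnertonDyer.Rank1Residual.X11b.AcSelmer
  Summit.BirchSwinnertonDyer.Rank1Residual.X11b.CongruenceLimit
  Summit.BirchSwinnertonDyer.Rank1Residual.X11b.Halves

namespace Summit.BirchSwinnertonDyer.Rank1Residual.X11b.Three

variable (W : WeierstrassCurve ℚ) [W.IsElliptic] [W.IsGloballyMinimal]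

/-- **H3 = MI-W3 at `3 ∥ N`, ORIENTATION-REPAIRED (form (a) of ORIENT-AUDIT-19270; hypothesis-shaped,
OPEN).** Over S0's datum (verbatim the binders of `Three.IMCDivAt₃`): for every degree-one `𝔭 ∋ 3`, the
newform `f` of `E`, every embedding datum `ι'` INDUCING `𝔭` and every frame `(Ω_K ≠ 0, Ω_p ∈ R₀ˣ, L ∈ R₀⟦T⟧)`
with Castella's interpolation property at `(ι', 𝔭)`, and EVERY prime `𝔭bar ∋ 3` of `K` with `𝔭bar ≠ 𝔭`
(for the imaginary quadratic `K` of the datum: the conjugate prime, automatically of degree one), the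
frame's `L` divides the base change of the characteristic ideal of the anticyclotomic Selmer dual STRICT
AT `𝔭bar`: `Ch_Λ(X_ac^∅ 𝔭bar)·R₀⟦T⟧ ⊆ (L)` in `R₀⟦T⟧` (LOWER bound only; base change along
`toUnr 3 : ℤ_3 → R₀`). The ONLY difference from `Three.IMCDivAt₃` is the X-slot prime (there: `𝔭`, the
frame's own prime — the registered atom, MISSTATED-ORIENTATION CONFIRMED by the cell's audit); every
print-facing binder is byte-identical. TYPED, not attempted; nothing asserted.
[cite: Castella2018, §1 (1.b) (arXiv p. 3) and Thm. 4.4 (p. 11) (shape only; nothing asserted at p = 3)]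
[cite: KellerYin2024, Def. 3.4.1 and Thm. 3.5.1 (frame at v, Selmer strict at v̄)]
[cite: CastellaGrossiLeeSkinner2022, §2.3 and Lemma 1.1.1 (the (v, v̄) slotting)] -/
@[conjecture]
def IMCDivAt₃B : Prop :=
  ∀ (N : ℕ) [NeZero N] (K : Type) [Field K] [NumberField K] (Dt : ModularParametrizationData W N)
    (H : HeegnerDatum N (NumberField.discr K)) (ι : K →+* ℂ) (P : (W.baseChange K).toAffine.Point),
    ClassX11b W 3 → Surj W 3 → W.conductorNorm ℤ = N → IsImaginaryQuadratic K →
    Odd (NumberField.discr K) → SatisfiesHeegnerHypothesis N K →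
    (W.quadraticTwist (NumberField.discr K : ℚ)).entireLFunction 1 ≠ 0 →
    WeierstrassCurve.Affine.Point.map ι.toRatAlgHom P = heegnerPointComplex Dt H →
    ¬ (3 : ℤ) ∣ Dt.c → ¬ IsOfFinAddOrder P →
    ∀ (κ : ZpExtension K 3), κ.IsAnticyclotomic →
      ∀ (γ : Field.absoluteGaloisGroup K) [Fact (κ.IsTopGenerator γ)]
        (𝔭 : HeightOneSpectrum (𝓞 K)), ((3 : ℕ) : 𝓞 K) ∈ 𝔭.asIdeal →
        𝔭.asIdeal.ramificationIdx (𝓞 ℚ) = 1 → 𝔭.asIdeal.inertiaDeg (𝓞 ℚ) = 1 →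
        ∀ (f : CuspForm (CongruenceSubgroup.Gamma0 N) 2), IsNewformOf W f →
          ∀ (ι' : PadicAlgCl 3 ≃+* ℂ), InducesPrime ι' 𝔭 →
            ∀ (ΩK : ℂ) (Ωp : (unrIntegers 3)ˣ) (L : UnrSeries 3), ΩK ≠ 0 →
              IsBDPLFunction ι' 𝔭 κ γ f ΩK ((Ωp : unrIntegers 3) : ℂ_[3]) L →
                ∀ (𝔭bar : HeightOneSpectrum (𝓞 K)), ((3 : ℕ) : 𝓞 K) ∈ 𝔭bar.asIdeal → 𝔭bar ≠ 𝔭 →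
                  (XAc.charIdeal (W.baseChange K) 3 κ 𝔭bar ∅ γ).map (PowerSeries.map (toUnr 3)) ≤
                    Ideal.span {L}

variable {W} in
omit [W.IsElliptic] [W.IsGloballyMinimal] in
/-- **Bookkeeping: a prime-blind supplier serves the oriented atom.** If, over S0's datum, EVERY frame at
`(ι', 𝔭)` divides the base change of `Ch_Λ(X_ac^∅ 𝔮)` at EVERY prime `𝔮 ∋ 3` of `K` (the shape a
`ι`-invariant supplier would have), then `Three.IMCDivAt₃B W` holds (take `𝔮 := 𝔭bar`). Nothing is
asserted; the hypothesis is at least as strong as either orientation. [folklore] -/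
theorem imcDivAt₃B_of_forall_prime
    (h : ∀ (N : ℕ) [NeZero N] (K : Type) [Field K] [NumberField K] (Dt : ModularParametrizationData W N)
      (H : HeegnerDatum N (NumberField.discr K)) (ι : K →+* ℂ) (P : (W.baseChange K).toAffine.Point),
      ClassX11b W 3 → Surj W 3 → W.conductorNorm ℤ = N → IsImaginaryQuadratic K →
      Odd (NumberField.discr K) → SatisfiesHeegnerHypothesis N K →
      (W.quadraticTwist (NumberField.discr K : ℚ)).entireLFunction 1 ≠ 0 →
      WeierstrassCurve.Affine.Point.map ι.toRatAlgHom P = heegnerPointComplex Dt H →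
      ¬ (3 : ℤ) ∣ Dt.c → ¬ IsOfFinAddOrder P →
      ∀ (κ : ZpExtension K 3), κ.IsAnticyclotomic →
        ∀ (γ : Field.absoluteGaloisGroup K) [Fact (κ.IsTopGenerator γ)]
          (𝔭 : HeightOneSpectrum (𝓞 K)), ((3 : ℕ) : 𝓞 K) ∈ 𝔭.asIdeal →
          𝔭.asIdeal.ramificationIdx (𝓞 ℚ) = 1 → 𝔭.asIdeal.inertiaDeg (𝓞 ℚ) = 1 →
          ∀ (f : CuspForm (CongruenceSubgroup.Gamma0 N) 2), IsNewformOf W f →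
            ∀ (ι' : PadicAlgCl 3 ≃+* ℂ), InducesPrime ι' 𝔭 →
              ∀ (ΩK : ℂ) (Ωp : (unrIntegers 3)ˣ) (L : UnrSeries 3), ΩK ≠ 0 →
                IsBDPLFunction ι' 𝔭 κ γ f ΩK ((Ωp : unrIntegers 3) : ℂ_[3]) L →
                  ∀ (𝔮 : HeightOneSpectrum (𝓞 K)), ((3 : ℕ) : 𝓞 K) ∈ 𝔮.asIdeal →
                    (XAc.charIdeal (W.baseChange K) 3 κ 𝔮 ∅ γ).map (PowerSeries.map (toUnr 3)) ≤
                      Ideal.span {L}) :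
    IMCDivAt₃B W := by
  intro N _ K _ _ Dt H ι P hX hsurj hN hK hodd hheeg hL1 hP hc hP0 κ hκ γ _ 𝔭 h𝔭 he hf f hfW ι' hι'
    ΩK Ωp L hΩK hL 𝔭bar h𝔭bar _
  exact h N K Dt H ι P hX hsurj hN hK hodd hheeg hL1 hP hc hP0 κ hκ γ 𝔭 h𝔭 he hf f hfW ι' hι' ΩK Ωp L
    hΩK hL 𝔭bar h𝔭bar

end Summit.BirchSwinnertonDyer.Rank1Residual.X11b.Three

end
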